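import Literature.Computability.Complexity.RossmanMonotoneCliqueApprox
import Literature.Computability.Complexity.RossmanMonotoneCliqueCounting
import Literature.Computability.Complexity.RossmanMonotoneCliqueGraphs
import HarnessLib

/-!
# Rossman 2010, Theorem 1 at a fixed (large) number of vertices

The proof of Theorem 1 of B. Rossman, *The monotone complexity of k-clique on random graphs*
(FOCS 2010; full version 2009, §6, pp. 8–9) carried out at ONE number of vertices `n` satisfying
explicit largeness conditions; the sequence form and the discharge
`Rossman2010_cliqueVsSubcritical_holds` are in `RossmanMonotoneCliqueProofs.lean`. The two
halves of §6 as finite statements about a monotone Boolean graph function `f` (the output `C̄` of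
the ⋆-closed approximation of `RossmanMonotoneCliqueApprox.lean`):

* `one_sub_lt_prob_of_dense` — **Lemma 15, first half**: if a `θ`-dense family of `k`-sets `A`
  carries accepted subgraphs `Q_A ⊆ K_A` with `supp Q_A = A` and `≤ ℓ` edges (cliques minus an
  edge accepted by `C̄`), and the exponent condition making `{E(Q_A)}` spread holds, then
  `Pr[f(G(n,p)) = 1] > 1 - ε` (the tree's proved spread lemma in place of Janson's inequality);
* `card_covered_cliques_le` — **Lemma 16 with Lemma 9 plugged in**: if every `k`-set `A` of a
  family `M` (the `A` with `K_A ∈ M(C̄)`) is covered by a minterm `H ∈ J`, `H ⊆ K_A`, of one of `L`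
  monotone ⋆-closed functions (the gates of `C̄`, Lemma 14), then
  `|M| ≤ L · C(n,k) · Σ_{(v,s)} (B log(s/t)/p)^s (k/n)^v`, the sum ranging over the signatures
  `(supp H, |E_H|)` of graphs `H ∈ J`;
* `sigWeight_le` — each signature weight is `≤ (2B)^{k²} k^k n^{-(k/4+1/8)}` (the exponent
  comparison `kappa_mul_sub_le` of `RossmanMonotoneCliqueGraphs.lean`, i.e. the end of §6);
* `LargeN k δ c₀ η n` — the explicit largeness conditions (all of the form "a fixed
  power/exponential of `n` beats a constant");
* `thm1_finite` — Theorem 1 for one such `n`, for circuits over `{∧₂, ∨₂, 0, 1}` of size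
  `≤ c₀ n^{k/4}` accepting a random `k`-clique with probability `≥ η`:
  `Pr[C(G(n, p⁻)) = 1] ≥ 1 - exp(-n^{c'})` with `p⁻ = n^{-2(1+δ)/(k-1)}`, `c' = cPrime k δ`.
  Proof: pass to a `{∧₂,∨₂}`-circuit (`const_or_exists_monotone_circuit`), take its ⋆-closed
  approximation `C̄` (`exists_closedApprox`); either the `k`-sets `A` with some accepted
  `K_A - e` are `η/2`-dense (Lemma 15 and Lemma 13 give the bound), or the `A` with
  `K_A ∈ M(C̄)` are `η/2`-dense (Lemmas 14, 16, 9 force `size ≥ Ω(n^{k/4 + 1/8})`, contradicting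
  the size bound).

## References

* B. Rossman, *The monotone complexity of k-clique on random graphs*, FOCS 2010, pp. 193–201
  (full version 2009-11-05), Theorem 1 (p. 4), §6 with Lemmas 13–16 (pp. 8–9) [Rossman2010].
-/

noncomputable section

namespace Literature.Computability.Complexity

open Finset GateList Real Literature.Combinatorics.SetFamily

variable {n : ℕ}

/-! ### Lemma 15: a dense family of accepted cliques-minus-an-edge forces acceptance of `G⁻` -/

/-- **Lemma 15, probabilistic half** (Rossman 2010, p. 9, with the spread lemma replacing
Janson's inequality): see the module docstring. [cite: Rossman2010, Lemma 15 (p. 9)] -/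
theorem one_sub_lt_prob_of_dense {k : ℕ} (hkn : k ≤ n) (hn : 0 < n) {p ε θ R : ℝ}
    (hp0 : 0 < p) (hp1 : p ≤ 1 / 2) (hε0 : 0 < ε) (hε1 : ε ≤ 1 / 2) {ℓ : ℕ} (hℓ : 1 ≤ ℓ)
    (hRr : spreadConst * Real.log (ℓ / ε) / p ≤ R)
    (f : ((⊤ : SimpleGraph (Fin n)).edgeSet → Bool) → Bool) (hf : Monotone f)
    (Bad : Finset (Finset (Fin n))) (hBad : Bad ⊆ powersetCard k univ) (hne : Bad.Nonempty)
    (hθ : θ * n.choose k ≤ #Bad) (Q : Finset (Fin n) → (⊤ : SimpleGraph (Fin n)).edgeSet → Bool)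
    (hQ : ∀ A ∈ Bad, Q A ≤ cliqueVec A ∧ supp (Q A) = A ∧ f (Q A) = true ∧ #(onSet (Q A)) ≤ ℓ)
    (hcond : ∀ Z : Finset ((⊤ : SimpleGraph (Fin n)).edgeSet), Z.Nonempty →
      (∃ A ∈ Bad, Z ⊆ onSet (Q A)) → R ^ #Z * (k : ℝ) ^ #(verts Z) ≤ θ * (n : ℝ) ^ #(verts Z)) :
    1 - ε < prob p (fun x => f x = true) := by
  set r := spreadConst * Real.log (ℓ / ε) / p with hr
  have hlog : 0 < Real.log (ℓ / ε) := by
    refine Real.log_pos ?_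
    rw [lt_div_iff₀ hε0]
    have : (1 : ℝ) ≤ ℓ := by exact_mod_cast hℓ
    linarith
  have hr0 : 0 < r := div_pos (mul_pos spreadConst_pos hlog) hp0
  have hR0 : 0 < R := hr0.trans_le hRr
  set F := Bad.image fun A => onSet (Q A) with hF
  have hsp : IsSpread r F :=
    isSpread_of_le (isSpread_image_of_clique_family hkn hn Bad hBad Q
      (fun A hA => ⟨(hQ A hA).1, (hQ A hA).2.1⟩) hR0 hθ hcond) hr0 hRr
  have hFne : F.Nonempty := hne.image _
  have hbdd : ∀ S ∈ F, #S ≤ ℓ := by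
    intro S hS
    obtain ⟨A, hA, rfl⟩ := mem_image.1 hS
    exact (hQ A hA).2.2.2
  have key := spread_lemma_spreadConst F ℓ p ε hℓ hp0 hp1 hε0 hε1 hFne hbdd hsp
  rw [sum_biasedWeight_filter_eq_prob] at key
  refine key.trans_le (prob_mono hp0.le (hp1.trans (by norm_num)) fun x ⟨S, hS, hSx⟩ => ?_)
  obtain ⟨A, hA, rfl⟩ := mem_image.1 hS
  exact eq_true_of_monotone_le hf ((le_iff_onSet_subset _ _).2 hSx) (hQ A hA).2.2.1

/-! ### Lemma 16 (with Lemma 9): few cliques are covered by medium minterms -/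

/-- The signature `(supp H, |E_H|)` of a graph. [folklore] -/
def sig (H : (⊤ : SimpleGraph (Fin n)).edgeSet → Bool) : ℕ × ℕ := (#(supp H), #(onSet H))

/-- The weight `(B log(s/t)/p)^s (k/n)^v` of a signature `(v, s)` in the final count.
[cite: Rossman2010, §6 (p. 9)] -/
def sigWeight (n k : ℕ) (p t : ℝ) (σ : ℕ × ℕ) : ℝ :=
  (spreadConst * Real.log (σ.2 / t) / p) ^ σ.2 * ((k : ℝ) / n) ^ σ.1

/-- **Lemma 16 combined with Lemma 9** (Rossman 2010, p. 9): see the module docstring.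
[cite: Rossman2010, Lemma 16 (p. 9)] -/
theorem card_covered_cliques_le {k : ℕ} (hkn : k ≤ n) (hn : 0 < n) {p t : ℝ} (hp0 : 0 < p)
    (hp1 : p ≤ 1 / 2) (ht0 : 0 < t) (ht1 : t ≤ 1 / 2) (L : ℕ)
    (g : ℕ → ((⊤ : SimpleGraph (Fin n)).edgeSet → Bool) → Bool)
    (hg : ∀ m < L, Monotone (g m) ∧ IsClosedFn p t (smallI n k ∪ medJ n k) (g m))
    (M : Finset (Finset (Fin n))) (hM : M ⊆ powersetCard k univ)
    (hcov : ∀ A ∈ M, ∃ m < L, ∃ H ∈ medJ n k, IsMinterm (g m) H ∧ H ≤ cliqueVec A) :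
    (#M : ℝ) ≤ L * (n.choose k * ∑ σ ∈ (medJ n k).image sig, sigWeight n k p t σ) := by
  classical
  -- the pairs (gate, medium minterm)
  set Pairs := ((range L) ×ˢ medJ n k).filter fun q => IsMinterm (g q.1) q.2 with hPairs
  -- Step 1: cover `M` by the fibres of the pairs
  have h1 : #M ≤ ∑ q ∈ Pairs, #((powersetCard k (univ : Finset (Fin n))).filter fun A => supp q.2 ⊆ A) := by
    calc #M ≤ #(Pairs.biUnion fun q => (powersetCard k (univ : Finset (Fin n))).filter fun A => supp q.2 ⊆ A) := by
          refine card_le_card fun A hA => ?_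
          obtain ⟨m, hm, H, hH, hmin, hle⟩ := hcov A hA
          rw [mem_biUnion]
          refine ⟨(m, H), ?_, ?_⟩
          · rw [hPairs, mem_filter, mem_product, mem_range]; exact ⟨⟨hm, hH⟩, hmin⟩
          · rw [mem_filter]; exact ⟨hM hA, (le_cliqueVec_iff H A).1 hle⟩
      _ ≤ _ := card_biUnion_le
  -- Step 2: each fibre has at most `C(n,k) (k/n)^{supp H}` elements
  have h2 : ∀ H : (⊤ : SimpleGraph (Fin n)).edgeSet → Bool,
      (#((powersetCard k (univ : Finset (Fin n))).filter fun A => supp H ⊆ A) : ℝ) ≤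
        n.choose k * ((k : ℝ) / n) ^ #(supp H) := by
    intro H
    have := card_filter_supset_mul_pow_le hkn (supp H)
    have hnv : (0 : ℝ) < (n : ℝ) ^ #(supp H) := by positivity
    rw [div_pow, mul_div_assoc', le_div_iff₀ hnv]
    calc (#((powersetCard k (univ : Finset (Fin n))).filter fun A => supp H ⊆ A) : ℝ) * (n : ℝ) ^ #(supp H)
        ≤ (k : ℝ) ^ #(supp H) * n.choose k := by exact_mod_cast this
      _ = n.choose k * (k : ℝ) ^ #(supp H) := by ring
  -- Step 3: for each gate, group the medium minterms by signature and apply Lemma 9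
  have h3 : ∀ m < L, ∑ H ∈ (medJ n k).filter (fun H => IsMinterm (g m) H), ((k : ℝ) / n) ^ #(supp H)
      ≤ ∑ σ ∈ (medJ n k).image sig, sigWeight n k p t σ := by
    intro m hm
    set Jm := (medJ n k).filter (fun H => IsMinterm (g m) H) with hJm
    rw [← sum_fiberwise_of_maps_to (s := Jm) (t := (medJ n k).image sig) (g := sig)
      (fun H hH => mem_image_of_mem sig (mem_of_mem_filter H hH))]
    refine sum_le_sum fun σ hσ => ?_
    obtain ⟨H₀, hH₀, rfl⟩ := mem_image.1 hσ
    have hs1 : 1 ≤ (sig H₀).2 := (medJ_ineq hH₀).1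
    calc ∑ H ∈ Jm.filter (fun H => sig H = sig H₀), ((k : ℝ) / n) ^ #(supp H)
        = ∑ H ∈ Jm.filter (fun H => sig H = sig H₀), ((k : ℝ) / n) ^ (sig H₀).1 := by
          refine sum_congr rfl fun H hH => ?_
          rw [(mem_filter.1 hH).2.symm]; rfl
      _ = #(Jm.filter fun H => sig H = sig H₀) * ((k : ℝ) / n) ^ (sig H₀).1 := by
          rw [sum_const, nsmul_eq_mul]
      _ ≤ (spreadConst * Real.log ((sig H₀).2 / t) / p) ^ (sig H₀).2 * ((k : ℝ) / n) ^ (sig H₀).1 := by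
          refine mul_le_mul_of_nonneg_right ?_ (by positivity)
          refine card_minterms_le_of_isClosedFn hp0 hp1 ht0 ht1 (K := smallI n k ∪ medJ n k)
            (fun x hx y hyx => mem_smallI_union_medJ_of_le hx hyx) (hg m hm).1 (hg m hm).2 hs1 _
            fun H hH => ?_
          rw [mem_filter, hJm, mem_filter] at hH
          exact ⟨mem_union_right _ hH.1.1, hH.1.2, (congrArg Prod.snd hH.2 : _)⟩
  -- assemble
  calc (#M : ℝ) ≤ ∑ q ∈ Pairs, (#((powersetCard k (univ : Finset (Fin n))).filter fun A => supp q.2 ⊆ A) : ℝ) := by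
        exact_mod_cast h1
    _ ≤ ∑ q ∈ Pairs, n.choose k * ((k : ℝ) / n) ^ #(supp q.2) := sum_le_sum fun q _ => h2 q.2
    _ = n.choose k * ∑ q ∈ Pairs, ((k : ℝ) / n) ^ #(supp q.2) := by rw [mul_sum]
    _ = n.choose k * ∑ m ∈ range L, ∑ H ∈ (medJ n k).filter (fun H => IsMinterm (g m) H),
          ((k : ℝ) / n) ^ #(supp H) := by
        congr 1
        rw [hPairs, sum_filter, sum_product]
        refine sum_congr rfl fun m _ => ?_
        rw [sum_filter]
    _ ≤ n.choose k * ∑ m ∈ range L, ∑ σ ∈ (medJ n k).image sig, sigWeight n k p t σ := by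
        refine mul_le_mul_of_nonneg_left (sum_le_sum fun m hm => h3 m (mem_range.1 hm)) (Nat.cast_nonneg _)
    _ = L * (n.choose k * ∑ σ ∈ (medJ n k).image sig, sigWeight n k p t σ) := by
        rw [sum_const, card_range, nsmul_eq_mul]; ring

/-! ### Theorem 1 at a fixed large `n` -/

/-- The signature weights are uniformly small: for `H ∈ J`,
`(B log(s/t)/p⁻)^s (k/n)^v ≤ (2B)^{k²} k^k n^{-(k/4 + 1/8)}` once `log(k²) ≤ n^δ`
(Lemma 9's bound plugged into the final count of §6). [cite: Rossman2010, §6 (p. 9)] -/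
theorem sigWeight_le {k : ℕ} (hk : 5 ≤ k) {δ : ℝ} (hδ0 : 0 < δ) (hδ1 : δ ≤ 1 / (k : ℝ) ^ 3)
    (hn1 : 1 ≤ n) (hlog : Real.log ((k : ℝ) ^ 2) ≤ (n : ℝ) ^ δ)
    {H : (⊤ : SimpleGraph (Fin n)).edgeSet → Bool} (hH : H ∈ medJ n k) :
    sigWeight n k (pMinus k δ n) (tThr δ n) (sig H) ≤
      (2 * spreadConst) ^ (k ^ 2) * (k : ℝ) ^ k * (n : ℝ) ^ (-((k : ℝ) / 4 + 1 / 8)) := by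
  obtain ⟨hs1, hvk, hJ⟩ := medJ_ineq hH
  have hsv : #(onSet H) ≤ (#(supp H)).choose 2 := card_onSet_le_choose H
  set v := #(supp H) with hv
  set s := #(onSet H) with hs
  have hn' : (1 : ℝ) ≤ n := by exact_mod_cast hn1
  have hn0 : (0 : ℝ) < n := by linarith
  have hk1 : (1 : ℝ) ≤ k := by exact_mod_cast (show 1 ≤ k by omega)
  have hB1 : (1 : ℝ) ≤ 2 * spreadConst := by rw [spreadConst]; norm_num
  -- `log(s/t) ≤ 2 n^δ`
  have hs2 : 2 * (s : ℝ) ≤ (k : ℝ) ^ 2 :=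
    le_trans (by exact_mod_cast Nat.mul_le_mul_left 2 hsv) (two_mul_choose_two_le_sq (by omega))
  have hspos : (0 : ℝ) < s := by exact_mod_cast hs1
  have hlogst : Real.log (s / tThr δ n) ≤ 2 * (n : ℝ) ^ δ := by
    rw [tThr, Real.log_div hspos.ne' (Real.exp_pos _).ne', Real.log_exp]
    have : Real.log s ≤ Real.log ((k : ℝ) ^ 2) := Real.log_le_log hspos (by nlinarith)
    linarith
  have hlog0 : 0 ≤ Real.log (s / tThr δ n) := by
    rw [tThr, Real.log_div hspos.ne' (Real.exp_pos _).ne', Real.log_exp]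
    have : 0 ≤ Real.log s := Real.log_nonneg (by exact_mod_cast hs1)
    have : 0 ≤ (n : ℝ) ^ δ := Real.rpow_nonneg hn0.le δ
    linarith
  -- `1/p⁻ = n^{2(1+δ)/(k-1)}`
  have hpinv : (pMinus k δ n)⁻¹ = (n : ℝ) ^ (2 * (1 + δ) / ((k : ℝ) - 1)) := by
    rw [pMinus, neg_div, Real.rpow_neg hn0.le, inv_inv]
  have hp0 : 0 < pMinus k δ n := Real.rpow_pos_of_pos hn0 _
  -- the base
  have hbase : spreadConst * Real.log (s / tThr δ n) / pMinus k δ n ≤ 2 * spreadConst * (n : ℝ) ^ kappa k δ := by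
    rw [div_eq_mul_inv, hpinv, kappa, Real.rpow_add hn0]
    have h1 : spreadConst * Real.log (s / tThr δ n) ≤ spreadConst * (2 * (n : ℝ) ^ δ) :=
      mul_le_mul_of_nonneg_left hlogst spreadConst_pos.le
    have h2 : 0 ≤ (n : ℝ) ^ (2 * (1 + δ) / ((k : ℝ) - 1)) := Real.rpow_nonneg hn0.le _
    nlinarith [mul_le_mul_of_nonneg_right h1 h2]
  have hbase0 : 0 ≤ spreadConst * Real.log (s / tThr δ n) / pMinus k δ n :=
    div_nonneg (mul_nonneg spreadConst_pos.le hlog0) hp0.le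
  -- the power
  have hpow : (spreadConst * Real.log (s / tThr δ n) / pMinus k δ n) ^ s ≤
      (2 * spreadConst) ^ (k ^ 2) * (n : ℝ) ^ (kappa k δ * s) := by
    calc (spreadConst * Real.log (s / tThr δ n) / pMinus k δ n) ^ s
        ≤ (2 * spreadConst * (n : ℝ) ^ kappa k δ) ^ s := pow_le_pow_left₀ hbase0 hbase s
      _ = (2 * spreadConst) ^ s * (n : ℝ) ^ (kappa k δ * s) := by
          rw [mul_pow, ← Real.rpow_natCast ((n : ℝ) ^ kappa k δ) s, ← Real.rpow_mul hn0.le]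
      _ ≤ (2 * spreadConst) ^ (k ^ 2) * (n : ℝ) ^ (kappa k δ * s) := by
          refine mul_le_mul_of_nonneg_right (pow_le_pow_right₀ hB1 ?_) (Real.rpow_nonneg hn0.le _)
          have : (s : ℝ) ≤ (k : ℝ) ^ 2 := by linarith
          exact_mod_cast this
  have hkv : ((k : ℝ) / n) ^ v = (k : ℝ) ^ v * (n : ℝ) ^ (-(v : ℝ)) := by
    rw [div_pow, Real.rpow_neg hn0.le, Real.rpow_natCast, div_eq_mul_inv]
  have hkk : (k : ℝ) ^ v ≤ (k : ℝ) ^ k := pow_le_pow_right₀ hk1 (by omega)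
  have hexp := kappa_mul_sub_le hk hδ0 hδ1 hsv hvk hJ
  rw [sigWeight, show (sig H).1 = v from rfl, show (sig H).2 = s from rfl, hkv]
  calc (spreadConst * Real.log (s / tThr δ n) / pMinus k δ n) ^ s * ((k : ℝ) ^ v * (n : ℝ) ^ (-(v : ℝ)))
      ≤ (2 * spreadConst) ^ (k ^ 2) * (n : ℝ) ^ (kappa k δ * s) * ((k : ℝ) ^ k * (n : ℝ) ^ (-(v : ℝ))) := by
        refine mul_le_mul hpow (mul_le_mul_of_nonneg_right hkk (Real.rpow_nonneg hn0.le _)) ?_ ?_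
        · exact mul_nonneg (pow_nonneg (by linarith) _) (Real.rpow_nonneg hn0.le _)
        · exact mul_nonneg (pow_nonneg (by linarith) _) (Real.rpow_nonneg hn0.le _)
    _ = (2 * spreadConst) ^ (k ^ 2) * (k : ℝ) ^ k * (n : ℝ) ^ (kappa k δ * s - v) := by
        rw [sub_eq_add_neg, Real.rpow_add hn0]; ring
    _ ≤ (2 * spreadConst) ^ (k ^ 2) * (k : ℝ) ^ k * (n : ℝ) ^ (-((k : ℝ) / 4 + 1 / 8)) := by
        refine mul_le_mul_of_nonneg_left (Real.rpow_le_rpow_of_exponent_le hn' hexp) ?_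
        exact mul_nonneg (pow_nonneg (by linarith) _) (pow_nonneg (by linarith) _)

/-- There are at most `k (k² + 1)` signatures of graphs in `J`. [folklore] -/
theorem card_image_sig_medJ_le {k : ℕ} : #((medJ n k).image sig) ≤ k * (k ^ 2 + 1) := by
  have : (medJ n k).image sig ⊆ range k ×ˢ range (k ^ 2 + 1) := by
    intro σ hσ
    obtain ⟨H, hH, rfl⟩ := mem_image.1 hσ
    obtain ⟨-, hvk, -⟩ := medJ_ineq hH
    have hsv := card_onSet_le_choose H
    have h2 := two_mul_choose_two_add #(supp H)
    rw [mem_product, mem_range, mem_range, sig]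
    refine ⟨by omega, ?_⟩
    have : (#(supp H)).choose 2 ≤ #(supp H) * #(supp H) := by omega
    have : #(supp H) * #(supp H) ≤ k * k := Nat.mul_le_mul (by omega) (by omega)
    calc #(onSet H) ≤ k * k := by omega
      _ < k ^ 2 + 1 := by rw [sq]; omega
  refine (card_le_card this).trans ?_
  rw [card_product, card_range, card_range]

/-- **Explicit largeness conditions on `n`** under which the proof of Theorem 1 goes through
(each is eventually true, `RossmanMonotoneCliqueProofs.lean`): `p⁻, e^{-n^δ}, e^{-n^c} ≤ 1/2`,
three "a constant `≤` a power of `n`" conditions, and the two terminal comparisons of the two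
cases of the proof. [cite: Rossman2010, §6 (p. 9)] -/
structure LargeN (k : ℕ) (δ c₀ η : ℝ) (n : ℕ) : Prop where
  /-- `n ≥ k` -/
  hkn : k ≤ n
  /-- `p⁻ < 1/2` -/
  hp : pMinus k δ n < 1 / 2
  /-- `e^{-n^δ} ≤ 1/2` -/
  ht : tThr δ n ≤ 1 / 2
  /-- `e^{-n^c} ≤ 1/2` -/
  hε : Real.exp (-((n : ℝ) ^ cExp k δ)) ≤ 1 / 2
  /-- `log k² ≤ n^δ` (Lemma 9's base) -/
  hlog9 : Real.log ((k : ℝ) ^ 2) ≤ (n : ℝ) ^ δ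
  /-- `log C(k,2) ≤ n^c` (Lemma 15's base) -/
  hlogq : Real.log (k.choose 2 : ℝ) ≤ (n : ℝ) ^ cExp k δ
  /-- `2B ≤ n^c` -/
  hB : 2 * spreadConst ≤ (n : ℝ) ^ cExp k δ
  /-- `2 k^k ≤ η n^{slack/2}` (Lemma 15's spread condition) -/
  hγ : 2 * (k : ℝ) ^ k ≤ η * (n : ℝ) ^ (slack k δ / 2)
  /-- the final count beats `η/2` -/
  hcase2 : max c₀ 1 * ((k * (k ^ 2 + 1) : ℕ) : ℝ) * ((2 * spreadConst) ^ (k ^ 2) * (k : ℝ) ^ k) *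
    (n : ℝ) ^ (-(1 / 8 : ℝ)) < η / 2
  /-- the error terms of Lemma 15 are below `e^{-n^{c'}}` -/
  hfinal : Real.exp (-((n : ℝ) ^ cExp k δ)) +
    max c₀ 1 * (2 : ℝ) ^ (k ^ 2) * (n : ℝ) ^ ((k : ℝ) / 4 + k) * tThr δ n ≤
      Real.exp (-((n : ℝ) ^ cPrime k δ))

/-- **Rossman 2010, Theorem 1, at one large `n`** (§6, pp. 8–9): for `k ≥ 5`, `0 < δ ≤ k⁻³`,
`η > 0`, `n` satisfying `LargeN k δ c₀ η n`, and a circuit `C` over `{∧₂, ∨₂, 0, 1}` on the edges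
of `Kₙ` with `size C ≤ c₀ n^{k/4}` and `Pr_A[C(K_A) = 1] ≥ η`, one has
`Pr[C(G(n, p⁻)) = 1] ≥ 1 - exp(-n^{c'})`, `p⁻ = n^{-2(1+δ)/(k-1)}`, `c' = cPrime k δ`. Proof: pass
to a `{∧₂,∨₂}`-circuit, take its ⋆-closed approximation `C̄`; either the `k`-sets `A` with some
accepted `K_A - e` are `η/2`-dense (then Lemma 15 via the spread lemma and Lemma 13 give the
bound) or the `A` with `K_A ∈ M(C̄)` are `η/2`-dense (then Lemmas 14, 16 and 9 force
`size ≥ Ω(n^{k/4 + 1/8})`, contradicting the size bound). [cite: Rossman2010, Thm 1 (p. 4; proof §6)] -/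
theorem thm1_finite {k : ℕ} (hk : 5 ≤ k) {δ : ℝ} (hδ0 : 0 < δ) (hδ1 : δ ≤ 1 / (k : ℝ) ^ 3)
    {c₀ η : ℝ} (hη : 0 < η) (hn : LargeN k δ c₀ η n)
    (C : Circuit ((⊤ : SimpleGraph (Fin n)).edgeSet)) (hC : C.IsOver monotoneBasis01)
    (hsize : (C.size : ℝ) ≤ c₀ * (n : ℝ) ^ ((k : ℝ) / 4))
    (hacc : η ≤ kSubsetProb n k fun A => C.eval (cliqueVec A) = true) :
    1 - Real.exp (-((n : ℝ) ^ cPrime k δ)) ≤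
      gnpProb n (pMinus k δ n) (univ.filter fun x => C.eval x = true) := by
  classical
  have hkn := hn.hkn
  have hn0 : 0 < n := by omega
  have hnr : (0 : ℝ) < n := by exact_mod_cast hn0
  have hn1 : (1 : ℝ) ≤ n := by exact_mod_cast hn0
  have hk' : (5 : ℝ) ≤ k := by exact_mod_cast hk
  set p := pMinus k δ n with hp
  set t := tThr δ n with ht
  have hp0 : 0 < p := Real.rpow_pos_of_pos hnr _
  have hplt : p < 1 / 2 := hn.hp
  have hp1 : p ≤ 1 / 2 := hplt.le
  have hp1' : p ≤ 1 := by linarith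
  have ht0 : 0 < t := Real.exp_pos _
  have ht1 : t ≤ 1 / 2 := hn.ht
  have htp : t < 1 - p := by linarith
  rw [gnpProb_filter_eq_prob]
  have hexp0 := Real.exp_pos (-((n : ℝ) ^ cPrime k δ))
  -- reduce to `{∧₂, ∨₂}`-circuits
  rcases const_or_exists_monotone_circuit C.gates C.output (wf_gates C) hC C.wf_output with
    ⟨b, hb⟩ | ⟨C', hC', hsize', hC'eval⟩
  · cases b
    · exfalso
      have : kSubsetProb n k (fun A => C.eval (cliqueVec A) = true) = 0 := by
        unfold kSubsetProb
        rw [filter_false_of_mem, card_empty, Nat.cast_zero, zero_div]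
        intro A _
        rw [circuit_eval, hb]; exact Bool.false_ne_true
      linarith
    · have : prob p (fun x => C.eval x = true) = 1 := by
        rw [← prob_true (ι := (⊤ : SimpleGraph (Fin n)).edgeSet) p]
        exact prob_congr fun x => by rw [circuit_eval, hb]; simp
      rw [this]; linarith
  -- the main case
  have heval : ∀ x, C'.eval x = C.eval x := fun x => by rw [hC'eval, circuit_eval]
  set L := C'.gates.length with hL
  have hLsize : (L : ℝ) ≤ max c₀ 1 * (n : ℝ) ^ ((k : ℝ) / 4) := by
    have h1 : (L : ℝ) ≤ C.size := by exact_mod_cast hsize'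
    have h2 : c₀ * (n : ℝ) ^ ((k : ℝ) / 4) ≤ max c₀ 1 * (n : ℝ) ^ ((k : ℝ) / 4) :=
      mul_le_mul_of_nonneg_right (le_max_left _ _) (Real.rpow_nonneg hnr.le _)
    linarith
  obtain ⟨ap, hap⟩ := exists_closedApprox hp0.le hp1' ht0.le htp
    (fun e => indVec_singleton_mem_smallI (n := n) hk e)
    (fun x hx y hy => sup_mem_smallI_union_medJ hx hy) C'.gates (wf_gates C') hC'
  set fbar := ap C'.output with hfbar
  have hout : OutOK C'.gates.length C'.output := C'.wf_output
  have hfm : Monotone fbar := hap.mono _ hout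
  have hfdom : ∀ x, C.eval x = true → fbar x = true := fun x hx =>
    hap.dom _ hout x (by rw [← circuit_eval, heval]; exact hx)
  set K := smallI n k ∪ medJ n k with hK
  have hKcard : (#K : ℝ) ≤ (n : ℝ) ^ (k : ℝ) * (2 : ℝ) ^ (k ^ 2) := by
    have h1 := card_smallI_union_medJ_le (n := n) hkn
    have h2 : n.choose k ≤ n ^ k := Nat.choose_le_pow n k
    have h3 : 2 ^ k.choose 2 ≤ 2 ^ (k ^ 2) := Nat.pow_le_pow_right (by norm_num)
      (by have := two_mul_choose_two_add k; nlinarith)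
    have : #K ≤ n ^ k * 2 ^ (k ^ 2) := h1.trans (Nat.mul_le_mul h2 h3)
    have : (#K : ℝ) ≤ ((n ^ k * 2 ^ (k ^ 2) : ℕ) : ℝ) := by exact_mod_cast this
    rw [Real.rpow_natCast]; push_cast at this; exact this
  have hsub : ∀ x, (fbar x = true ∧ ¬ C.eval x = true) →
      ∃ m < C'.gates.length, (vals C'.gates x).getD m false ≠ ap (.inr m) x := by
    rintro x ⟨h1, h2⟩
    by_contra hbad
    have := hap.agree hbad _ hout
    rw [← circuit_eval, heval] at this
    exact h2 (this.trans h1)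
  have hferr : prob p (fun x => fbar x = true ∧ ¬ C.eval x = true) ≤
      max c₀ 1 * (2 : ℝ) ^ (k ^ 2) * (n : ℝ) ^ ((k : ℝ) / 4 + k) * t := by
    refine (prob_mono hp0.le hp1' hsub).trans (hap.err.trans ?_)
    rw [Real.rpow_add hnr]
    have : (L : ℝ) * (#K * t) ≤ (max c₀ 1 * (n : ℝ) ^ ((k : ℝ) / 4)) * ((n : ℝ) ^ (k : ℝ) * (2 : ℝ) ^ (k ^ 2) * t) :=
      mul_le_mul hLsize (mul_le_mul_of_nonneg_right hKcard ht0.le) (by positivity) (by positivity)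
    refine this.trans (le_of_eq ?_); ring
  -- the cliques minus an accepted edge
  set badP : Finset (Fin n) → Prop := fun A =>
    ∃ e, cliqueVec A e = true ∧ fbar (Function.update (cliqueVec A) e false) = true with hbadP
  by_cases hcase : η / 2 ≤ kSubsetProb n k badP
  · -- Case 1 (Lemma 15): a dense family of accepted cliques minus an edge
    set Bad := (powersetCard k (univ : Finset (Fin n))).filter badP with hBad
    have hθ : η / 2 * n.choose k ≤ #Bad := by
      have := card_ge_of_le_kSubsetProb hkn badP hcase; linarith
    have hBadne : Bad.Nonempty := by
      rw [← card_pos]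
      have hc : (0 : ℝ) < n.choose k := by exact_mod_cast Nat.choose_pos hkn
      have : (0 : ℝ) < #Bad := lt_of_lt_of_le (by positivity) hθ
      exact_mod_cast this
    -- choose the edge
    set Q : Finset (Fin n) → (⊤ : SimpleGraph (Fin n)).edgeSet → Bool := fun A =>
      if h : badP A then Function.update (cliqueVec A) h.choose false else cliqueVec A with hQ
    have hQspec : ∀ A ∈ Bad, ∃ e, cliqueVec A e = true ∧ Q A = Function.update (cliqueVec A) e false ∧
        fbar (Q A) = true := by
      intro A hA
      have h : badP A := (mem_filter.1 hA).2
      refine ⟨h.choose, h.choose_spec.1, ?_, ?_⟩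
      · simp only [hQ, dif_pos h]
      · simp only [hQ, dif_pos h]; exact h.choose_spec.2
    have hAk : ∀ A ∈ Bad, #A = k := fun A hA => (mem_powersetCard.1 (mem_filter.1 hA).1).2
    set ℓ := k.choose 2 - 1 with hℓ
    have hk2 : 10 ≤ k.choose 2 := by
      have := Nat.choose_le_choose 2 hk
      rwa [show Nat.choose 5 2 = 10 from rfl] at this
    have hℓ1 : 1 ≤ ℓ := by omega
    have hQprop : ∀ A ∈ Bad, Q A ≤ cliqueVec A ∧ supp (Q A) = A ∧ fbar (Q A) = true ∧ #(onSet (Q A)) ≤ ℓ := by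
      intro A hA
      obtain ⟨e, he, hQA, hfQ⟩ := hQspec A hA
      rw [hQA]
      refine ⟨update_false_le _ e, supp_update_cliqueVec (by rw [hAk A hA]; omega) e, hQA ▸ hfQ, ?_⟩
      have h1 := card_onSet_update_false he
      have h2 := card_onSet_cliqueVec_le A
      rw [hAk A hA] at h2
      omega
    -- parameters of the spread lemma
    set ε := Real.exp (-((n : ℝ) ^ cExp k δ)) with hε
    have hε0 : 0 < ε := Real.exp_pos _
    have hε1 : ε ≤ 1 / 2 := hn.hε
    set R := (n : ℝ) ^ kappaP k δ with hR
    have hpinv : p⁻¹ = (n : ℝ) ^ (2 * (1 + δ) / ((k : ℝ) - 1)) := by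
      rw [hp, pMinus, neg_div, Real.rpow_neg hnr.le, inv_inv]
    have hRr : spreadConst * Real.log (ℓ / ε) / p ≤ R := by
      have hℓpos : (0 : ℝ) < ℓ := by exact_mod_cast hℓ1
      have hlogℓ : Real.log ℓ ≤ (n : ℝ) ^ cExp k δ := by
        refine le_trans (Real.log_le_log hℓpos ?_) hn.hlogq
        exact_mod_cast Nat.sub_le _ _
      have hlog : Real.log (ℓ / ε) ≤ 2 * (n : ℝ) ^ cExp k δ := by
        rw [Real.log_div hℓpos.ne' hε0.ne', hε, Real.log_exp]; linarith
      rw [div_eq_mul_inv, hpinv, hR, kappaP, Real.rpow_add hnr,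
        show 2 * cExp k δ = cExp k δ + cExp k δ by ring, Real.rpow_add hnr]
      have h1 : spreadConst * Real.log (ℓ / ε) ≤ (n : ℝ) ^ cExp k δ * (n : ℝ) ^ cExp k δ := by
        calc spreadConst * Real.log (ℓ / ε) ≤ spreadConst * (2 * (n : ℝ) ^ cExp k δ) :=
              mul_le_mul_of_nonneg_left hlog spreadConst_pos.le
          _ = (2 * spreadConst) * (n : ℝ) ^ cExp k δ := by ring
          _ ≤ (n : ℝ) ^ cExp k δ * (n : ℝ) ^ cExp k δ :=
              mul_le_mul_of_nonneg_right hn.hB (Real.rpow_nonneg hnr.le _)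
      have h2 : 0 ≤ (n : ℝ) ^ (2 * (1 + δ) / ((k : ℝ) - 1)) := Real.rpow_nonneg hnr.le _
      nlinarith [mul_le_mul_of_nonneg_right h1 h2]
    have hcond : ∀ Z : Finset ((⊤ : SimpleGraph (Fin n)).edgeSet), Z.Nonempty →
        (∃ A ∈ Bad, Z ⊆ onSet (Q A)) → R ^ #Z * (k : ℝ) ^ #(verts Z) ≤ η / 2 * (n : ℝ) ^ #(verts Z) := by
      rintro Z hZ ⟨A, hA, hZA⟩
      obtain ⟨hQle, -, -, hQcard⟩ := hQprop A hA
      have hvA : verts Z ⊆ A := verts_subset_of_subset_onSet hZA hQle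
      have hvk : #(verts Z) ≤ k := (card_le_card hvA).trans (hAk A hA).le
      have hv2 : 2 ≤ #(verts Z) := two_le_card_verts hZ
      have hzv : #Z ≤ (#(verts Z)).choose 2 := card_le_choose_card_verts Z
      have hzk : #Z + 1 ≤ k.choose 2 := by have := card_le_card hZA; omega
      have hexp := kappaP_mul_add_le hk hδ0 hδ1 hv2 hvk hzv hzk
      have hk1 : (1 : ℝ) ≤ k := by linarith
      have hkk : (k : ℝ) ^ #(verts Z) ≤ (k : ℝ) ^ k := pow_le_pow_right₀ hk1 hvk
      have hRz : R ^ #Z = (n : ℝ) ^ (kappaP k δ * #Z) := by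
        rw [hR, ← Real.rpow_natCast, ← Real.rpow_mul hnr.le]
      have hγ := hn.hγ
      calc R ^ #Z * (k : ℝ) ^ #(verts Z)
          ≤ (n : ℝ) ^ ((#(verts Z) : ℝ) - slack k δ / 2) * (k : ℝ) ^ k := by
            rw [hRz]
            exact mul_le_mul (Real.rpow_le_rpow_of_exponent_le hn1 (by linarith)) hkk
              (by positivity) (Real.rpow_nonneg hnr.le _)
        _ = (n : ℝ) ^ #(verts Z) * ((k : ℝ) ^ k * ((n : ℝ) ^ (slack k δ / 2))⁻¹) := by
            rw [sub_eq_add_neg, Real.rpow_add hnr, Real.rpow_neg hnr.le, Real.rpow_natCast]; ring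
        _ ≤ (n : ℝ) ^ #(verts Z) * (η / 2) := by
            refine mul_le_mul_of_nonneg_left ?_ (by positivity)
            have hs0 : (0 : ℝ) < (n : ℝ) ^ (slack k δ / 2) := Real.rpow_pos_of_pos hnr _
            rw [mul_inv_le_iff₀ hs0]; linarith
        _ = η / 2 * (n : ℝ) ^ #(verts Z) := by ring
    have hbig := one_sub_lt_prob_of_dense hkn hn0 hp0 hp1 hε0 hε1 hℓ1 hRr fbar hfm Bad
      (filter_subset _ _) hBadne hθ Q hQprop hcond
    -- conclude with Lemma 13
    have hsplit := prob_le_prob_add_prob_and_not hp0.le hp1' (fun x => fbar x = true) (fun x => C.eval x = true)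
    have hfin := hn.hfinal
    linarith
  · -- Case 2 (Lemmas 14, 16, 9): many cliques are minterms of `C̄` — impossible for small circuits
    exfalso
    rw [not_le] at hcase
    set mintP : Finset (Fin n) → Prop := fun A => IsMinterm fbar (cliqueVec A) with hmintP
    have hmint : η / 2 ≤ kSubsetProb n k mintP := by
      have h1 : η ≤ kSubsetProb n k fun A => fbar (cliqueVec A) = true :=
        hacc.trans (kSubsetProb_mono fun A hA => hfdom _ hA)
      have h2 := kSubsetProb_le_add (n := n) (k := k) (fun A => fbar (cliqueVec A) = true) mintP
      have h3 : kSubsetProb n k (fun A => fbar (cliqueVec A) = true ∧ ¬ mintP A) ≤ kSubsetProb n k badP := by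
        refine kSubsetProb_mono fun A ⟨hA1, hA2⟩ => ?_
        by_contra hb
        refine hA2 (isMinterm_of_forall_update hfm hA1 fun e he => ?_)
        by_contra hf
        rw [Bool.not_eq_false] at hf
        exact hb ⟨e, he, hf⟩
      linarith
    set M := (powersetCard k (univ : Finset (Fin n))).filter mintP with hM
    have hMcard : η / 2 * n.choose k ≤ #M := by
      have := card_ge_of_le_kSubsetProb hkn mintP hmint; linarith
    -- Lemma 14: every minterm clique is covered by a medium minterm of some gate
    have hcov : ∀ A ∈ M, ∃ m < L, ∃ H ∈ medJ n k, IsMinterm (ap (.inr m)) H ∧ H ≤ cliqueVec A := by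
      intro A hA
      rw [hM, mem_filter, mem_powersetCard] at hA
      by_contra hno
      push Not at hno
      have hloc := hap.loc (cliqueVec A) (fun m hm H hH hle hJ => hno m hm H hJ hH hle) _ hout
        (cliqueVec A) hA.2 le_rfl
      rw [mem_smallI, supp_cliqueVec (by rw [hA.1.2]; omega), hA.1.2] at hloc
      omega
    have hg : ∀ m < L, Monotone (ap (.inr m)) ∧ IsClosedFn p t (smallI n k ∪ medJ n k) (ap (.inr m)) := by
      intro m hm
      have hw : OutOK C'.gates.length (.inr m : (⊤ : SimpleGraph (Fin n)).edgeSet ⊕ ℕ) := by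
        intro m' h; cases h; exact hm
      exact ⟨hap.mono _ hw, hap.closed _ hw⟩
    have hcount := card_covered_cliques_le hkn hn0 hp0 hp1 ht0 ht1 L (fun m => ap (.inr m)) hg M
      (filter_subset _ _) hcov
    -- the sum of signature weights is small
    set Ψ := ∑ σ ∈ (medJ n k).image sig, sigWeight n k p t σ with hΨ
    set W₀ := (2 * spreadConst) ^ (k ^ 2) * (k : ℝ) ^ k with hW₀
    have hW₀0 : 0 ≤ W₀ := by rw [hW₀]; have := spreadConst_pos; positivity
    have hWn0 : 0 ≤ W₀ * (n : ℝ) ^ (-((k : ℝ) / 4 + 1 / 8)) := mul_nonneg hW₀0 (Real.rpow_nonneg hnr.le _)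
    have hΨle : Ψ ≤ ((k * (k ^ 2 + 1) : ℕ) : ℝ) * (W₀ * (n : ℝ) ^ (-((k : ℝ) / 4 + 1 / 8))) := by
      calc Ψ ≤ ∑ σ ∈ (medJ n k).image sig, W₀ * (n : ℝ) ^ (-((k : ℝ) / 4 + 1 / 8)) := by
            refine sum_le_sum fun σ hσ => ?_
            obtain ⟨H, hH, rfl⟩ := mem_image.1 hσ
            exact sigWeight_le hk hδ0 hδ1 hn0 hn.hlog9 hH
        _ = #((medJ n k).image sig) * (W₀ * (n : ℝ) ^ (-((k : ℝ) / 4 + 1 / 8))) := by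
            rw [sum_const, nsmul_eq_mul]
        _ ≤ _ := by
            refine mul_le_mul_of_nonneg_right ?_ hWn0
            exact_mod_cast card_image_sig_medJ_le
    have hchoose : (0 : ℝ) < n.choose k := by exact_mod_cast Nat.choose_pos hkn
    -- η/2 ≤ L Ψ
    have h1 : η / 2 ≤ L * Ψ := by
      have : η / 2 * n.choose k ≤ L * Ψ * n.choose k := by
        calc η / 2 * n.choose k ≤ #M := hMcard
          _ ≤ L * (n.choose k * Ψ) := hcount
          _ = L * Ψ * n.choose k := by ring
      exact le_of_mul_le_mul_right this hchoose
    have hΨ0 : 0 ≤ Ψ := sum_nonneg fun σ hσ => by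
      obtain ⟨H, hH, rfl⟩ := mem_image.1 hσ
      have hs1 : 1 ≤ (sig H).2 := (medJ_ineq hH).1
      have hspos : (0 : ℝ) < (sig H).2 := by exact_mod_cast hs1
      unfold sigWeight
      refine mul_nonneg (pow_nonneg (div_nonneg (mul_nonneg spreadConst_pos.le ?_) hp0.le) _)
        (by positivity)
      rw [ht, tThr, Real.log_div hspos.ne' (Real.exp_pos _).ne', Real.log_exp]
      have : 0 ≤ Real.log ((sig H).2) := Real.log_nonneg (by exact_mod_cast hs1)
      have : 0 ≤ (n : ℝ) ^ δ := Real.rpow_nonneg hnr.le δ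
      linarith
    have h2 : (L : ℝ) * Ψ ≤ max c₀ 1 * (n : ℝ) ^ ((k : ℝ) / 4) * Ψ := mul_le_mul_of_nonneg_right hLsize hΨ0
    have h3 : max c₀ 1 * (n : ℝ) ^ ((k : ℝ) / 4) * Ψ ≤
        max c₀ 1 * ((k * (k ^ 2 + 1) : ℕ) : ℝ) * W₀ * (n : ℝ) ^ (-(1 / 8 : ℝ)) := by
      calc max c₀ 1 * (n : ℝ) ^ ((k : ℝ) / 4) * Ψ
          ≤ max c₀ 1 * (n : ℝ) ^ ((k : ℝ) / 4) * (((k * (k ^ 2 + 1) : ℕ) : ℝ) * (W₀ * (n : ℝ) ^ (-((k : ℝ) / 4 + 1 / 8)))) :=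
            mul_le_mul_of_nonneg_left hΨle (by positivity)
        _ = max c₀ 1 * ((k * (k ^ 2 + 1) : ℕ) : ℝ) * W₀ * ((n : ℝ) ^ ((k : ℝ) / 4) * (n : ℝ) ^ (-((k : ℝ) / 4 + 1 / 8))) := by ring
        _ = _ := by rw [← Real.rpow_add hnr]; congr 1; ring
    have h4 := hn.hcase2
    linarith

end Literature.Computability.Complexity
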